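import Literature.NumberTheory.Automorphic.MeyerUnramifiedReduction
import HarnessLib

/-!
# Meyer's global difference representation — proofs, V: unramified representatives in `H⁰₋`

Topic `NumberTheory/Automorphic`; namespace `Literature.NumberTheory.Automorphic.Meyer`. Sibling
PROOF file of `MeyerDifferenceRepresentation` (Step A of the plan for
`Meyer.spectralRealisation_rat` [Meyer2005, Thm. 5.11]). After `MeyerUnramifiedReduction`
(`𝒪̂ˣ` fixes the relevant generalised eigenvectors of `π₋`), this file produces FUNCTION
representatives:

* `exists_eq_mk_iMinus` — every `v ∈ H⁰₋ = (H₊ + H₋)/H₊` is the class of a diagonal vector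
  `i₋ f = (f, f)`, `f ∈ H₋` (`H₊ + H₋ = H₊ ⊔ i₋(H₋)`), i.e. `H⁰₋ ≅ H₋/(H₊ ∩ H₋)` [Meyer2005, §5.5];
* **`exists_unramified_rep`** — if `v` is fixed by `π₋(𝒪̂ˣ)` then `v = [i₋ f]` with `f ∈ H₋`
  INVARIANT under `𝒪̂ˣ` (average a representative over the finite quotient `𝒪̂ˣ/U`, `U` an open
  stabiliser; each `λ_u f₀ - f₀`, `u ∈ 𝒪̂ˣ`, lies in `H₊` because `v` is fixed) — the passage to the
  unramified part `V^S`, `S = {∞}` [Meyer2005, §5.1–5.2].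

Everything is proved; no definitions, no named facts.

## References

* R. Meyer, *On a representation of the idele class group related to primes and zeros of
  L-functions*, Duke Math. J. 127 (2005) = arXiv:math/0311468, §5.1, §5.2, §5.5 [Meyer2005].
-/

noncomputable section

open MeasureTheory NumberField IsDedekindDomain
open scoped NNReal

namespace Literature.NumberTheory.Automorphic.Meyer

section Diagonal

variable {K : Type} [Field K] [NumberField K] [MeasurableSpace (AdeleRing (𝓞 K) K)]
  (μ : Measure (AdeleRing (𝓞 K) K))

/-- `i₋ f ∈ H₊ + H₋` for `f ∈ H₋`. [cite: Meyer2005, §5.5] -/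
theorem iMinus_mem_Hsum {f : IdeleClassGroup K → ℂ} (hf : f ∈ Hminus K) : iMinus K f ∈ Hsum K μ :=
  Submodule.mem_sup_right ⟨f, hf, rfl⟩

/-- Two vectors of `H₊ + H₋` have the same class in `H⁰₋` iff they differ by a vector of `H₊`.
[cite: Meyer2005, §5.5] -/
theorem mk_eq_mk_iff_sub_mem_Hplus (p q : Hsum K μ) :
    (Submodule.Quotient.mk p : HzeroMinus K μ) = Submodule.Quotient.mk q ↔
      (p : (IdeleClassGroup K → ℂ) × (IdeleClassGroup K → ℂ)) - q ∈ Hplus K μ := by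
  rw [Submodule.Quotient.eq, HplusIn, Submodule.mem_comap, Submodule.coe_subtype, Submodule.coe_sub]

/-- **`H⁰₋ ≅ H₋/(H₊ ∩ H₋)`, pointwise**: every `v ∈ H⁰₋ = (H₊ + H₋)/H₊` is the class of a diagonal
vector `i₋ f`, `f ∈ H₋`. [cite: Meyer2005, §5.5] -/
theorem exists_eq_mk_iMinus (v : HzeroMinus K μ) :
    ∃ (f : IdeleClassGroup K → ℂ) (hf : f ∈ Hminus K),
      v = Submodule.Quotient.mk ⟨iMinus K f, iMinus_mem_Hsum μ hf⟩ := by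
  obtain ⟨p, rfl⟩ := Submodule.Quotient.mk_surjective _ v
  obtain ⟨a, ha, b, hb, hab⟩ := Submodule.mem_sup.mp p.2
  obtain ⟨f, hf, rfl⟩ := hb
  refine ⟨f, hf, ?_⟩
  rw [mk_eq_mk_iff_sub_mem_Hplus]
  have : (p : (IdeleClassGroup K → ℂ) × (IdeleClassGroup K → ℂ)) - iMinus K f = a := by
    rw [← hab, add_sub_cancel_right]
  rw [Submodule.coe_mk, this]
  exact ha

end Diagonal

/-! ### Averaging over `𝒪̂ˣ/U` -/

section Average

variable {K : Type} [Field K] [NumberField K]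

/-- `i₋` intertwines `λ` and `λ ⊕ λ`. [cite: Meyer2005, §5.3] -/
theorem iMinus_classTranslate (g : IdeleClassGroup K) (f : IdeleClassGroup K → ℂ) :
    iMinus K (classTranslate K g f) = classTranslate₂ K g (iMinus K f) := by
  rw [iMinus_apply, iMinus_apply, classTranslate₂_apply]

variable [MeasurableSpace (AdeleRing (𝓞 K) K)] [BorelSpace (AdeleRing (𝓞 K) K)]
  (μ : Measure (AdeleRing (𝓞 K) K)) [μ.IsAddHaarMeasure]

omit [BorelSpace (AdeleRing (𝓞 K) K)] [μ.IsAddHaarMeasure] in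
/-- If `[i₋ f₀] ∈ H⁰₋` is fixed by `π₋(g)` then `(λ ⊕ λ)_g (i₋ f₀) - i₋ f₀ ∈ H₊`. [cite: Meyer2005, §5.5] -/
theorem classTranslate₂_iMinus_sub_mem_Hplus {f₀ : IdeleClassGroup K → ℂ} (hf₀ : f₀ ∈ Hminus K)
    {g : IdeleClassGroup K}
    (hfix : piMinus K μ g (Submodule.Quotient.mk ⟨iMinus K f₀, iMinus_mem_Hsum μ hf₀⟩) =
      Submodule.Quotient.mk ⟨iMinus K f₀, iMinus_mem_Hsum μ hf₀⟩) :
    classTranslate₂ K g (iMinus K f₀) - iMinus K f₀ ∈ Hplus K μ := by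
  rw [piMinus, Representation.quotient_apply, Submodule.mapQ_apply, mk_eq_mk_iff_sub_mem_Hplus] at hfix
  rw [sumRep, Representation.subrepresentation_apply, LinearMap.restrict_apply] at hfix
  exact hfix

omit [MeasurableSpace (AdeleRing (𝓞 K) K)] [BorelSpace (AdeleRing (𝓞 K) K)] [μ.IsAddHaarMeasure] in
/-- Right translation as a left translation: `x ↦ f₀ (x g)` is `λ_{g⁻¹} f₀`. [folklore] -/
theorem classTranslate_inv_eq (g : IdeleClassGroup K) (f₀ : IdeleClassGroup K → ℂ) :
    classTranslate K g⁻¹ f₀ = fun x => f₀ (x * g) := by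
  funext x
  rw [classTranslate_apply]
  exact congrArg f₀ ((congrArg (· * x) (inv_inv g)).trans (mul_comm g x))

omit [MeasurableSpace (AdeleRing (𝓞 K) K)] [BorelSpace (AdeleRing (𝓞 K) K)] [μ.IsAddHaarMeasure] in
/-- `i₋` of a right translate is the `(λ ⊕ λ)`-translate of `i₋`. [cite: Meyer2005, §5.3] -/
theorem iMinus_translate_eq (g : IdeleClassGroup K) (f₀ : IdeleClassGroup K → ℂ) :
    iMinus K (fun x => f₀ (x * g)) = classTranslate₂ K g⁻¹ (iMinus K f₀) := by
  rw [← classTranslate_inv_eq, iMinus_classTranslate]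

omit [MeasurableSpace (AdeleRing (𝓞 K) K)] [BorelSpace (AdeleRing (𝓞 K) K)] [μ.IsAddHaarMeasure] in
/-- `H₋` is invariant under right translations. [cite: Meyer2005, §4.1] -/
theorem translate_mem_Hminus {f₀ : IdeleClassGroup K → ℂ} (hf₀ : f₀ ∈ Hminus K) (g : IdeleClassGroup K) :
    (fun x => f₀ (x * g)) ∈ Hminus K := by
  rw [← classTranslate_inv_eq]
  exact classTranslate_mem_ideleClassSchwartzWeighted hf₀ _

omit [MeasurableSpace (AdeleRing (𝓞 K) K)] [BorelSpace (AdeleRing (𝓞 K) K)] [μ.IsAddHaarMeasure] in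
/-- A finite average of right translates of an element of `H₋` lies in `H₋`. [cite: Meyer2005, §4.1] -/
theorem sum_translate_mem_Hminus {ι : Type} (s : Finset ι) (c : ℂ) (g : ι → IdeleClassGroup K)
    {f₀ : IdeleClassGroup K → ℂ} (hf₀ : f₀ ∈ Hminus K) :
    (fun x => c * ∑ i ∈ s, f₀ (x * g i)) ∈ Hminus K := by
  have hfun : (fun x => c * ∑ i ∈ s, f₀ (x * g i)) = c • ∑ i ∈ s, (fun x => f₀ (x * g i)) := by
    funext x
    simp only [Pi.smul_apply, Finset.sum_apply, smul_eq_mul]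
  rw [hfun]
  exact Submodule.smul_mem _ c (Submodule.sum_mem _ fun i _ => translate_mem_Hminus hf₀ (g i))

omit [BorelSpace (AdeleRing (𝓞 K) K)] [μ.IsAddHaarMeasure] in
/-- **Unramified representatives** [Meyer2005, §5.1–5.2]: if `v ∈ H⁰₋` is fixed by `π₋(u)` for all
`u ∈ 𝒪̂ˣ`, then `v = [i₋ f]` for some `f ∈ H₋` which is INVARIANT under `𝒪̂ˣ`
(`f (x · u) = f x`). Proof: write `v = [i₋ f₀]`, `f₀ ∈ H₋ ⊆ 𝒮(C_K)` is fixed by an open `U`;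
average `f₀` over representatives of the finite quotient `𝒪̂ˣ/U`; the average is `𝒪̂ˣ`-invariant,
lies in `H₋`, and differs from `f₀` (under `i₋`) by a sum of vectors `(λ⊕λ)_u (i₋ f₀) - i₋ f₀ ∈ H₊`.
[cite: Meyer2005, §5.2] -/
theorem exists_unramified_rep (v : HzeroMinus K μ)
    (hv : ∀ u ∈ integralFiniteUnits K, piMinus K μ (finiteUnitClass K u) v = v) :
    ∃ (f : IdeleClassGroup K → ℂ) (hf : f ∈ Hminus K),
      (∀ u ∈ integralFiniteUnits K, ∀ x, f (x * finiteUnitClass K u) = f x) ∧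
        v = Submodule.Quotient.mk ⟨iMinus K f, iMinus_mem_Hsum μ hf⟩ := by
  classical
  obtain ⟨f₀, hf₀, rfl⟩ := exists_eq_mk_iMinus μ v
  -- an open stabiliser of `f₀`
  have hf₀S : f₀ ∈ ideleClassSchwartz K := by
    have h := (mem_ideleClassSchwartzWeighted_iff.mp hf₀) 0 (Set.mem_univ _)
    have hw : weightMul K 0 f₀ = f₀ := by
      funext x
      rw [weightMul_apply, Real.rpow_zero, Complex.ofReal_one, mul_one]
    rwa [hw] at h
  obtain ⟨U, hU⟩ := (mem_ideleClassSchwartz_iff.mp hf₀S).exists_openSubgroup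
  -- the finite quotient `𝒪̂ˣ / U`
  set C : Subgroup (FiniteAdeleRing (𝓞 K) K)ˣ := integralFiniteUnits K with hC
  set U' : Subgroup C := (U : Subgroup (FiniteAdeleRing (𝓞 K) K)ˣ).comap C.subtype with hU'
  haveI : Finite (C ⧸ U') := finite_quotient_comap_of_isOpen U
  haveI : Fintype (C ⧸ U') := Fintype.ofFinite _
  set R : C ⧸ U' → C := Quotient.out with hR
  have hRmk : ∀ q : C ⧸ U', (QuotientGroup.mk (R q) : C ⧸ U') = q := fun q => Quotient.out_eq q
  set N : ℕ := Fintype.card (C ⧸ U') with hN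
  have hNpos : 0 < N := Fintype.card_pos
  have hN0 : (N : ℂ) ≠ 0 := by exact_mod_cast hNpos.ne'
  -- the average
  set f : IdeleClassGroup K → ℂ := fun x => (N : ℂ)⁻¹ * ∑ q : C ⧸ U', f₀ (x * finiteUnitClass K ((R q : C) : (FiniteAdeleRing (𝓞 K) K)ˣ)) with hf
  have hfH : f ∈ Hminus K := sum_translate_mem_Hminus Finset.univ _ _ hf₀
  refine ⟨f, hfH, ?_, ?_⟩
  · -- invariance under `C`
    intro u hu x
    simp only [hf]
    congr 1
    -- reindex along `q ↦ [u] q`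
    set uC : C := ⟨u, hu⟩ with huC
    have hterm : ∀ q : C ⧸ U',
        f₀ (x * finiteUnitClass K u * finiteUnitClass K ((R q : C) : (FiniteAdeleRing (𝓞 K) K)ˣ)) =
          f₀ (x * finiteUnitClass K ((R ((QuotientGroup.mk uC : C ⧸ U') * q) : C) : (FiniteAdeleRing (𝓞 K) K)ˣ)) := by
      intro q
      -- `R([u] q) = u R(q) w` with `w ∈ U`
      obtain ⟨w, hw⟩ := QuotientGroup.mk_out_eq_mul U' (uC * R q)
      have hq : (QuotientGroup.mk uC : C ⧸ U') * q = QuotientGroup.mk (uC * R q) := by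
        rw [QuotientGroup.mk_mul, hRmk]
      rw [hq]
      change f₀ (x * finiteUnitClass K u * finiteUnitClass K ((R q : C) : (FiniteAdeleRing (𝓞 K) K)ˣ)) =
        f₀ (x * finiteUnitClass K (((QuotientGroup.mk (uC * R q) : C ⧸ U').out : C) : (FiniteAdeleRing (𝓞 K) K)ˣ))
      rw [hw]
      have hwU : ((w : C) : (FiniteAdeleRing (𝓞 K) K)ˣ) ∈ U := w.2
      rw [Subgroup.coe_mul, Subgroup.coe_mul, map_mul, map_mul, ← mul_assoc, hU _ hwU, huC, mul_assoc]
    simp_rw [hterm]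
    exact Fintype.sum_equiv (Equiv.mulLeft (QuotientGroup.mk uC : C ⧸ U')) _ _ fun q => rfl
  · -- same class: `i₋ f - i₋ f₀ ∈ H₊`
    rw [mk_eq_mk_iff_sub_mem_Hplus, Submodule.coe_mk, Submodule.coe_mk, ← neg_sub]
    refine Submodule.neg_mem _ ?_
    have hf' : f = (N : ℂ)⁻¹ • ∑ q : C ⧸ U',
        (fun x => f₀ (x * finiteUnitClass K ((R q : C) : (FiniteAdeleRing (𝓞 K) K)ˣ))) := by
      funext x
      simp only [hf, Pi.smul_apply, Finset.sum_apply, smul_eq_mul]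
    have hdiff : iMinus K f - iMinus K f₀ = (N : ℂ)⁻¹ • ∑ q : C ⧸ U',
        (classTranslate₂ K (finiteUnitClass K ((R q : C) : (FiniteAdeleRing (𝓞 K) K)ˣ))⁻¹ (iMinus K f₀) - iMinus K f₀) := by
      rw [hf', map_smul, map_sum, Finset.sum_sub_distrib, smul_sub]
      congr 1
      · simp_rw [iMinus_translate_eq]
      · rw [Finset.sum_const, Finset.card_univ, ← hN, ← Nat.cast_smul_eq_nsmul ℂ, smul_smul,
          inv_mul_cancel₀ hN0, one_smul]
    rw [hdiff]
    refine Submodule.smul_mem _ _ (Submodule.sum_mem _ fun q _ => ?_)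
    rw [← map_inv]
    exact classTranslate₂_iMinus_sub_mem_Hplus μ hf₀ (hv _ (inv_mem (R q).2))

end Average

end Literature.NumberTheory.Automorphic.Meyer
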